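import Summits.BirchSwinnertonDyer.Rank1Residual.X5.SelmerSolitaireQuadraticMove
import Summits.BirchSwinnertonDyer.Rank1Residual.X5.SelmerSolitaireQuadraticCoreTest
import HarnessLib

/-!
# Selmer solitaire, QUADRATIC-SPACE LAYER (ii‴) — Q4 (sequel): the move in normal form IS `extend`, `moveIsExtension_holds : MoveIsExtension` (QS2b)

Cell `b2b-bsdres`, O1 programme (p = 2), ORDER v2.9 pool slot (ii‴) (o1 lead GEN 20, R-G20.3/R-G20.4,
PLAN C150/C153), second half of file Q4 (split off `…QuadraticMove.lean` for the 400-line lint); pool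
hand x11b3-p4 GEN 5. Imports Q4 (`X5.SelmerSolitaireQuadraticMove`: QS2a `moveForced_at`) and Q2
(`X5.SelmerSolitaireQuadraticCoreTest`: `isTSLagrangian_nfSpace`, `mem_nfSpace_iff`, the `nfVec`
coordinates).

HONEST FRAMING (cell, verbatim): research route; pure `𝔽₂` linear algebra — no curve, no Galois group,
no prime; nothing arithmetic asserted (the dictionary AR1–AR4 is NOT here); reach-neutral (R1 closes
no class); nothing booked; no mark / label / count moved; O1 OPEN. THEOREMS ONLY (no definition, no
named fact, no `sorry`).

## What is proved (lens-2 GEN 5 T3 (ii) / Prop C, GEN 10 2G10.2 QS2b; reserved name `moveIsExtension_holds`)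
`MoveIsExtension : ∀ s P b N L, IsTSLagrangian L → K′_{ψ_N}(𝒰(P,b)) ⊆ L → u_q ∉ L → L = 𝒰(extend P N, b)`.
Proof = the uniqueness half of QS2a (`moveForced_at`) applied to `ψ_N` as a linear functional
(`psiN_add`, `psiN_smul`), since the normal form of the extension has the three properties:
(i) it is a totally singular Lagrangian (Q2 `isTSLagrangian_nfSpace` at `s + 1`); (ii) it contains
`K′_{ψ_N}`: **`ι(nfVec P b ε z) + ψ_N(·) u_q = nfVec (extend P (indic N)) b ε (z, 0)`**
(`iota_nfVec_add_psiN_smul`, coordinate by coordinate: `nfVec_extend_oldV`, `nfVec_extend_new`,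
`psiN_nfVec`, the tree's `extend_S_*` entries of the one-vertex extension); (iii) it avoids `u_q`
(`uNew_not_mem_nfSpace`: a T3 vector with all `t`-coordinates and the `λ`-coordinate `0` is `0`).
END: **`moveIsExtension_holds : MoveIsExtension`**. Executable evidence (lens-2 GEN 10, EVIDENCE only):
`code/qs_layer_check.py`, 2 048 / 2 048 moves at `|D| = 3`.

## References
* lens-2 GEN 5 G5.2 T3 (ii) / Prop C, GEN 10 2G10.2 (`cells/o1/ROUTES-O1.md` l.1966–1988); B. Mazur,
  K. Rubin, Contemp. Math. 358 (2004), §5 (the graph `𝒳⁰`) [MazurRubin2004Intro]; B. Poonen, E. Rains,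
  JAMS 25 (2012), §4 [PoonenRains2012].
* Tree: `extend`, `extend_S_oldV_oldV` / `_new_oldV` / `_oldV_new` (`X5.SelmerSolitaireExtend`, p2).
  Dedup: `lean search 'moveIsExtension_holds|nfVec_extend|psiN_nfVec'` → reservations only.
-/

namespace Summit.BirchSwinnertonDyer.Rank1Residual.X5.SelmerSolitaire.Quadratic

open Finset Matrix SelmerSolitaire

variable {s : ℕ}

/-! ### QS2b: the move in normal form is `extend` -/

/-- Entries of `extend P N` at old vertices written as `some (castSucc i)` / `none`. [folklore] -/
theorem extend_S_cs_cs (P : Position s) (N : V s → ZMod 2) (i j : Fin s) :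
    (extend P N).S (some (Fin.castSucc i)) (some (Fin.castSucc j)) = P.S (some i) (some j) :=
  extend_S_oldV_oldV P N (some i) (some j)

/-- idem, `(castSucc i, ∞)`. [folklore] -/
theorem extend_S_cs_none (P : Position s) (N : V s → ZMod 2) (i : Fin s) :
    (extend P N).S (some (Fin.castSucc i)) none = P.S (some i) none :=
  extend_S_oldV_oldV P N (some i) none

/-- idem, `(castSucc i, q)`. [folklore] -/
theorem extend_S_cs_new (P : Position s) (N : V s → ZMod 2) (i : Fin s) :
    (extend P N).S (some (Fin.castSucc i)) (some (Fin.last s)) = N (some i) :=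
  extend_S_oldV_new P N (some i)

/-- idem, `(q, castSucc j)`. [folklore] -/
theorem extend_S_new_cs (P : Position s) (N : V s → ZMod 2) (j : Fin s) :
    (extend P N).S (some (Fin.last s)) (some (Fin.castSucc j)) = N (some j) :=
  extend_S_new_oldV P N (some j)

/-- idem, `(q, ∞)`. [folklore] -/
theorem extend_S_new_none (P : Position s) (N : V s → ZMod 2) :
    (extend P N).S (some (Fin.last s)) none = N none :=
  extend_S_new_oldV P N none

/-- `ψ_N` evaluated on a T3 vector: `Σ_{ℓ ∈ N} z_ℓ + [∞ ∈ N] ε`. [folklore] -/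
theorem psiN_nfVec (P : Position s) (b : Bool) (N : Finset (V s)) (ε : ZMod 2) (z : Fin s → ZMod 2) :
    psiN b N (nfVec P b ε z) = (∑ l, indic N (some l) * z l) + ε * indic N none := by
  simp only [psiN, nfVec_some_snd, lamCoord_nfVec_none, indic]
  congr 1
  · exact sum_congr rfl fun l _ => by split_ifs <;> simp
  · split_ifs <;> simp

/-- The T3 vector of the EXTENDED position with the new `t`-coordinate `0`, at the old vertices, is
the old T3 vector. [folklore] -/
theorem nfVec_extend_oldV (P : Position s) (N : V s → ZMod 2) (b : Bool) (ε : ZMod 2)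
    (z : Fin s → ZMod 2) (v : V s) :
    nfVec (extend P N) b ε (Fin.snoc z 0) (oldV v) = nfVec P b ε z v := by
  cases v with
  | none =>
    simp only [oldV, Option.map_none, nfVec, Fin.sum_univ_castSucc, Fin.snoc_castSucc, Fin.snoc_last,
      mul_zero, add_zero, extend_S_cs_none]
  | some i =>
    simp only [oldV, Option.map_some, nfVec, Fin.sum_univ_castSucc, Fin.snoc_castSucc, Fin.snoc_last,
      mul_zero, add_zero, extend_S_cs_cs, extend_S_cs_none]

/-- … and at the new vertex it is `(ψ_N-value, 0)`. [folklore] -/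
theorem nfVec_extend_new (P : Position s) (N : V s → ZMod 2) (b : Bool) (ε : ZMod 2)
    (z : Fin s → ZMod 2) :
    nfVec (extend P N) b ε (Fin.snoc z 0) (some (Fin.last s)) =
      ((∑ j, N (some j) * z j) + ε * N none, 0) := by
  simp only [nfVec, Fin.sum_univ_castSucc, Fin.snoc_castSucc, Fin.snoc_last, mul_zero, add_zero,
    extend_S_new_cs, extend_S_new_none]

/-- **`K′_{ψ_N}` lies in the normal form of the extension**: `ι(nfVec P b ε z) + ψ_N(·) u_q =
nfVec (extend P (indic N)) b ε (z, 0)` (lens-2 GEN 5 T3 (ii)). [folklore] -/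
theorem iota_nfVec_add_psiN_smul (P : Position s) (b : Bool) (N : Finset (V s)) (ε : ZMod 2)
    (z : Fin s → ZMod 2) :
    iota (nfVec P b ε z) + psiN b N (nfVec P b ε z) • uNew s =
      nfVec (extend P (indic N)) b ε (Fin.snoc z 0) := by
  rw [iota_add_smul_uNew, eq_iota_add_single (nfVec (extend P (indic N)) b ε (Fin.snoc z 0))]
  congr 2
  · funext v; exact (nfVec_extend_oldV P (indic N) b ε z v).symm
  · rw [nfVec_extend_new, psiN_nfVec]

/-- `ψ_N` is additive. [folklore] -/
theorem psiN_add (b : Bool) (N : Finset (V s)) (x y : QVec s) :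
    psiN b N (x + y) = psiN b N x + psiN b N y := by
  have hlam : ∀ p q : ZMod 2 × ZMod 2, lamCoord b (p + q) = lamCoord b p + lamCoord b q := by
    intro p q; cases b <;> rfl
  simp only [psiN, Pi.add_apply, Prod.snd_add, hlam]
  rw [show (∑ l, if some l ∈ N then (x (some l)).2 + (y (some l)).2 else (0 : ZMod 2)) =
      (∑ l, if some l ∈ N then (x (some l)).2 else 0) + ∑ l, if some l ∈ N then (y (some l)).2 else 0 by
    rw [← sum_add_distrib]; exact sum_congr rfl fun l _ => by split_ifs <;> simp]
  split_ifs <;> abel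

/-- `ψ_N` is homogeneous. [folklore] -/
theorem psiN_smul (b : Bool) (N : Finset (V s)) (c : ZMod 2) (x : QVec s) :
    psiN b N (c • x) = c * psiN b N x := by
  rcases (by decide : ∀ c : ZMod 2, c = 0 ∨ c = 1) c with rfl | rfl
  · rw [zero_smul, zero_mul]
    cases b <;> simp [psiN, lamCoord]
  · rw [one_smul, one_mul]

/-- `u_q ∉ 𝒰(P′, b)` for ANY position `P′` on `D ∪ {q}`: a T3 vector with all `t`-coordinates `0` and
`λ`-coordinate `0` is `0`. [folklore] -/
theorem uNew_not_mem_nfSpace (P' : Position (s + 1)) (b : Bool) : uNew s ∉ nfSpace P' b := by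
  intro h
  obtain ⟨ε, z, hz⟩ := (mem_nfSpace_iff P' b _).mp h
  have h2 : ∀ w : V (s + 1), (uNew s w).2 = 0 := fun w => by
    by_cases hw : w = some (Fin.last s)
    · subst hw; simp [uNew]
    · simp [uNew, Pi.single_eq_of_ne hw]
  have hε : ε = 0 := by
    have := congrArg (fun x => lamCoord b (x none)) hz
    simp only [lamCoord_nfVec_none] at this
    rw [← this]; simp [uNew]
  have hz0 : z = 0 := funext fun l => by
    have := congrArg (fun x => (x (some l)).2) hz
    simp only [nfVec_some_snd] at this
    rw [← this, h2]; rfl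
  rw [hε, hz0, nfVec_zero] at hz
  have := congrArg (fun x => (x (some (Fin.last s))).1) hz
  simp [uNew] at this

/-- **QS2b `MoveIsExtension` (lens-2 GEN 5 T3 (ii) / Prop C; GEN 10 2G10.2)**: in normal form, the
forced Lagrangian of the move by `ψ_N` is the normal form of the ONE-VERTEX EXTENSION `extend P N`
(new vertex `q ~ N`), same type bit. [cite: MazurRubin2004Intro, §5 (𝒳⁰)] -/
theorem moveIsExtension_holds : SelmerSolitaire.Quadratic.MoveIsExtension := by
  intro s P b N L hL hK hu
  -- `ψ_N` as a linear functional
  let ψ : QVec s →ₗ[ZMod 2] ZMod 2 :=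
    { toFun := psiN b N, map_add' := psiN_add b N, map_smul' := psiN_smul b N }
  have hψ : (ψ : QVec s → ZMod 2) = psiN b N := rfl
  have huniq := moveForced_at (nfSpace P b) ψ (isTSLagrangian_nfSpace P b)
  refine huniq.unique ⟨hL, hψ ▸ hK, hu⟩ ⟨isTSLagrangian_nfSpace _ b, ?_, uNew_not_mem_nfSpace _ b⟩
  rintro _ ⟨x, hx, rfl⟩
  obtain ⟨ε, z, rfl⟩ := (mem_nfSpace_iff P b x).mp hx
  rw [hψ, iota_nfVec_add_psiN_smul]
  exact (mem_nfSpace_iff _ b _).mpr ⟨ε, Fin.snoc z 0, rfl⟩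

end Summit.BirchSwinnertonDyer.Rank1Residual.X5.SelmerSolitaire.Quadratic
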